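import Summits.CriticalPhenomena.SAWScalingLimit.Theorems.SAWRenewalTightnessSubseqIdentificationTiltedOneStep
import Summits.CriticalPhenomena.SAWScalingLimit.Theorems.SAWRenewalTightnessSubseqIdentificationTiltedEnvelope
import HarnessLib

/-!
# The tilted martingale identities (line `boundary-area-law`, RS5b′/T2, Π): the frozen first moment, uniform form

Line `boundary-area-law` of the crux `SubseqIdentification` (stmt-CriticalPhenomena-0783), restriction
reshape (lead c4, r-c4-5), stub `stub_tiltedProductMartingale` (Π) = half of step (T2) of the tilted
[LSW] Theorem 6.5 (G. F. Lawler, O. Schramm, W. Werner, *Conformal restriction: the chordal case*,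
J. Amer. Math. Soc. **16** (2003), §5 (5.1)–(5.3) and Prop. 5.3).

The one-step input of the interior estimate of the product cell (`…TiltedProductInterior`), in the
UNIFORM, COEFFICIENT-FREE form consumed there (`exists_abs_integral_frozenProd_le`): for the tilting
exponents `α = (6−κ)/(2κ)`, `λ = (8−3κ)(6−κ)/(2κ)` and class constants `δ₀, ρ₀`, there is ONE constant `K`
(of the deterministic product expansion `exists_abs_prod_sub_model_le`) such that for every past `ω` alive at
`u` with `B = A_u − W_u` in the controlled class, driver bounded by `N` on `[0, u]`, and every small step `h`,

  `|E_{ω₂}[ΔW̃ · Ŷ′]| ≤ imageStepC κ c (d·d^α) (d^α c₂ (1+2α)) K (M₀ + 6α/ρ₀) M₁ · h√h`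

(`υ = concat_u(stop_u β(ω), β(ω₂))` the frozen path, `ΔW̃ = imageDrvFnK κ A (u+h) υ − imageDrvFnK κ A u υ`,
`Ŷ′ = D_{u+h}(υ)^α e^{−λ ∫ᵤ^{u+h} m(υ)}`, `d = Φ′_B(0)`, `c₂ = E_B″(0)`, `M₀ = 3482N + 15080√(u+h) + 1160R`,
`M₁ = 3482√κ`): the first-order term `h d^α c₂ (κ/2 − 3 + κα)` of the frozen conditional mean VANISHES for
`α = (6−κ)/(2κ)` (in print `d⟨W̃, Ỹ⟩ + Ỹ · (drift of W̃) = 0`). The proof is the one-step assembly of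
`…TiltedFrozen` (`abs_integral_sub_drift_le` of `SLEImageDriverOneStep` on top of the product expansion, the
deterministic expansions `abs_imageDriverStep_sub_model_le_of_mem_goodEventK` / `abs_compensatedStep_le` on the
good event and the envelope `abs_imageDrvFnK_concat_sub_le_of_abs_le` everywhere), written against the built
one-step and envelope files only.

References: [LSW] §5 (5.1)–(5.3), Prop. 5.3. No named fact is used.
-/

noncomputable section

open MeasureTheory Filter Topology Set Metric Function
open scoped NNReal ENNReal
open Literature.Probability.RandomPlanarGeometry
open Literature.Probability.Process (preWienerMeasure runSup runSup_nonneg integrable_runSup)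

namespace Summit.CriticalPhenomena.SAWScalingLimit.Theorems.SubseqIdentification.BoundaryAreaLaw

open Loewner PathOps

section Frozen

variable [MeasurableSpace C(ℝ≥0, ℝ)] [BorelSpace C(ℝ≥0, ℝ)]
variable {κ : ℝ≥0} {α lam : ℝ} {A : Set ℂ}

-- the one-step assembly (smallness, good event, bad event, measurability, first moment) in ONE proof needs
-- more than the default heartbeats (the split version elaborates each piece under the default budget)
set_option maxHeartbeats 800000 in
/-- **The frozen first moment of the product, uniform coefficient-free form** ([LSW] §5 (5.1)–(5.3) with
Prop. 5.3, one step, conditionally on the past): for `α = (6−κ)/(2κ)`, `λ = (8−3κ)(6−κ)/(2κ)`, `0 < κ ≤ 8/3`,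
`A ⊆ B̄(0, R)` and class constants `δ₀ > 0`, `0 < ρ₀ ≤ 1` there is `K ≥ 0` with: for every past `ω` alive at
`u` with `2δ₀ ≤ Φ′_{A_u − W_u}(0)`, `B(0, 16ρ₀)` off `A_u − W_u`, `|W| ≤ N` on `[0, u]`, and every step
`0 < h ≤ 3c₀²/256`, `λ h M_m ≤ 1`,
`|E_{ω₂}[ΔW̃ · Ŷ′]| ≤ imageStepC κ c (d·d^α) (d^α c₂ (1+2α)) K (M₀ + 6α/ρ₀) M₁ · h√h` — the first-order
coefficient `κ/2 − 3 + κα` vanishes. [cite: LawlerSchrammWerner2003Restriction, §5 (5.1)–(5.3) and Prop. 5.3] -/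
theorem exists_abs_integral_frozenProd_le (hκ0 : 0 < κ) (hκ : κ ≤ 8 / 3) (hαdef : α = (6 - κ) / (2 * κ))
    (hlamdef : lam = (8 - 3 * κ) * (6 - κ) / (2 * κ)) (hA : IsStarHull A) (hne : A.Nonempty) {R : ℝ} (hR0 : 0 < R)
    (hAR : A ⊆ closedBall (0 : ℂ) R) {δ₀ ρ₀ : ℝ} (hδ0 : 0 < δ₀) (hρ₀ : 0 < ρ₀) (hρ1 : ρ₀ ≤ 1) :
    ∃ K : ℝ, 0 ≤ K ∧ ∀ {u h : ℝ≥0} {ω : ℝ≥0 → ℝ} {N : ℝ},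
      Disjoint (closedHull (drvK κ (brownianCPath ω)) u) A →
      Disjoint (ball (0 : ℂ) (16 * ρ₀)) (slidHull (drvK κ (brownianCPath ω)) A u) →
      2 * δ₀ ≤ starDeriv (slidHull (drvK κ (brownianCPath ω)) A u) → 0 < h →
      (h : ℝ) ≤ 3 * (δ₀ * ρ₀ / 4000) ^ 2 / 256 → 0 ≤ N → (∀ s : ℝ≥0, s ≤ u → |drvK κ (brownianCPath ω) s| ≤ N) →
      lam * (h * massBound δ₀ ρ₀) ≤ 1 →
      |∫ ω₂, (imageDrvFnK κ A (u + h) (concat u (stop u (brownianCPath ω), brownianCPath ω₂)) -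
            imageDrvFnK κ A u (concat u (stop u (brownianCPath ω), brownianCPath ω₂))) *
          (DFnK κ A (u + h) (concat u (stop u (brownianCPath ω), brownianCPath ω₂)) ^ α *
            Real.exp (-(lam * JFnK κ A u h (concat u (stop u (brownianCPath ω), brownianCPath ω₂))))) ∂preWienerMeasure| ≤
      imageStepC κ (δ₀ * ρ₀ / 4000 * (Real.sqrt κ / stepSigma))
          (starDeriv (slidHull (drvK κ (brownianCPath ω)) A u) * starDeriv (slidHull (drvK κ (brownianCPath ω)) A u) ^ α)
          (starDeriv (slidHull (drvK κ (brownianCPath ω)) A u) ^ α * starJet2 (slidHull (drvK κ (brownianCPath ω)) A u) * (1 + 2 * α))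
          K ((3482 * N + (15080 * Real.sqrt ((u + h : ℝ≥0) : ℝ) + 1160 * R) + 6 * α / ρ₀)) (3482 * Real.sqrt κ) *
        h * Real.sqrt h := by
  -- adapted from SAWRenewalTightnessSubseqIdentificationTiltedFrozen.lean (`frozen_smallnessK`, `frozen_prod_good`,
  -- `frozen_prod_bad`, `measurable_frozen_prod`, `frozen_prod_integral_sub_le`), specialised to `(α′, λ′) = (α, λ)`
  haveI := isProbabilityMeasure_preWienerMeasure'
  obtain ⟨hαpos, hlam0⟩ := exponents_pos hκ hαdef hlamdef hκ0
  have hκ' : (0 : ℝ) < κ := by exact_mod_cast hκ0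
  have hsκ : 0 < Real.sqrt κ := Real.sqrt_pos.2 hκ'
  have hσ := stepSigma_pos
  have hK₁ : 0 ≤ stepK δ₀ ρ₀ := by rw [stepK]; positivity
  have hcompK0 : 0 ≤ compK α lam δ₀ ρ₀ := (compK_pos hαpos hlam0 hδ0 hρ₀).le
  have hK₂ : 0 ≤ compK α lam δ₀ ρ₀ * (stepSigma / Real.sqrt κ) := by positivity
  obtain ⟨K, hK0, hK⟩ := exists_abs_prod_sub_model_le hαpos hlam0 hδ0 hρ₀ hK₁ hK₂
  refine ⟨K, hK0, ?_⟩
  intro u h ω N halive hBρ hδ hh0 hh hN0 hN hlamh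
  -- smallness: `h ≤ c₀²/32`, `32h ≤ c₀²`, `32κh ≤ c²`, `h ≤ 1`, `0 < c ≤ 1` (`c₀ = δ₀ρ₀/4000`, `c = c₀√κ/σ`)
  set B := slidHull (drvK κ (brownianCPath ω)) A u with hBdef
  obtain ⟨hd0, hd1⟩ := starDeriv_pos_le_one B
  have hδ1 : δ₀ ≤ 1 := by linarith
  have hc00 : 0 < δ₀ * ρ₀ / 4000 := by positivity
  have hc01 : δ₀ * ρ₀ / 4000 ≤ 1 / 4000 := by
    rw [div_le_div_iff_of_pos_right (by norm_num)]
    have := mul_le_mul hδ1 hρ1 hρ₀.le zero_le_one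
    linarith
  have hratio : Real.sqrt κ / stepSigma ≤ 1 := by rw [div_le_one hσ]; exact sqrt_le_stepSigma hκ
  have hratio0 : 0 < Real.sqrt κ / stepSigma := by positivity
  have hh0' : (0 : ℝ) ≤ h := h.coe_nonneg
  have hsq : (δ₀ * ρ₀ / 4000 * (Real.sqrt κ / stepSigma)) ^ 2 = (δ₀ * ρ₀ / 4000) ^ 2 * (κ * (3 / 8)) := by
    rw [mul_pow, div_pow, div_pow, Real.sq_sqrt hκ'.le, stepSigma_sq]; ring
  have hh32' : (h : ℝ) ≤ (δ₀ * ρ₀ / 4000) ^ 2 / 32 := by nlinarith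
  have hh32 : 32 * (h : ℝ) ≤ (δ₀ * ρ₀ / 4000) ^ 2 := by nlinarith
  have hhκ : 32 * (κ : ℝ) * h ≤ (δ₀ * ρ₀ / 4000 * (Real.sqrt κ / stepSigma)) ^ 2 := by
    rw [hsq]
    have := mul_le_mul_of_nonneg_left hh (by positivity : (0 : ℝ) ≤ 32 * κ)
    nlinarith
  have hh1 : (h : ℝ) ≤ 1 := by
    have : (δ₀ * ρ₀ / 4000) ^ 2 ≤ 1 := by nlinarith
    nlinarith
  have hc0 : 0 < δ₀ * ρ₀ / 4000 * (Real.sqrt κ / stepSigma) := by positivity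
  -- the class at the frozen time
  have hB : IsStarHull B := Loewner.isStarHull_slidHull_of_disjoint (continuous_drvK κ _) hA halive
  have hBρ8 : Disjoint (ball (0 : ℂ) (8 * ρ₀)) B := hBρ.mono_left (ball_subset_ball (by linarith))
  have hδ' : δ₀ ≤ starDeriv B := by linarith
  obtain ⟨-, -, hc2, hc3, -⟩ := starJet_spec hB hρ₀ hBρ8
  set d : ℝ := starDeriv B with hd
  set c₂ : ℝ := starJet2 B with hc₂
  have hy0 : 0 ≤ d ^ α := Real.rpow_nonneg hd0.le _
  have hy1 : d ^ α ≤ 1 := Real.rpow_le_one hd0.le hd1 hαpos.le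
  set s : ℝ := 6 * α * d ^ α * c₂ * h with hs
  set Z : (ℝ≥0 → ℝ) → ℝ := fun ω₂ ↦ (imageDrvFnK κ A (u + h) (concat u (stop u (brownianCPath ω), brownianCPath ω₂)) -
      imageDrvFnK κ A u (concat u (stop u (brownianCPath ω), brownianCPath ω₂))) *
    (DFnK κ A (u + h) (concat u (stop u (brownianCPath ω), brownianCPath ω₂)) ^ α *
      Real.exp (-(lam * JFnK κ A u h (concat u (stop u (brownianCPath ω), brownianCPath ω₂))))) with hZ
  -- `Ŷ′ ∈ [0, 1]`
  have hYh01 : ∀ υ : C(ℝ≥0, ℝ), 0 ≤ DFnK κ A (u + h) υ ^ α * Real.exp (-(lam * JFnK κ A u h υ)) ∧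
      DFnK κ A (u + h) υ ^ α * Real.exp (-(lam * JFnK κ A u h υ)) ≤ 1 := fun υ ↦ by
    obtain ⟨-, -, e0, e1⟩ := DFnK_eq (κ := κ) (A := A) (u + h) υ
    have c1 : Real.exp (-(lam * JFnK κ A u h υ)) ≤ 1 := by
      rw [Real.exp_le_one_iff, neg_nonpos]; exact mul_nonneg hlam0 (JFnK_nonneg hA u h υ)
    exact ⟨mul_nonneg (Real.rpow_nonneg e0 _) (Real.exp_pos _).le, mul_le_one₀ (Real.rpow_le_one e0 e1 hαpos.le) (Real.exp_pos _).le c1⟩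
  have hM₀ : 0 ≤ (3482 * N + (15080 * Real.sqrt ((u + h : ℝ≥0) : ℝ) + 1160 * R) + 6 * α / ρ₀) := by positivity
  have hM₁ : (0 : ℝ) ≤ 3482 * Real.sqrt κ := by positivity
  -- measurability of the frozen product
  have hZm : Measurable fun ω₂ ↦ Z ω₂ - s := by
    have hc : Measurable fun ω₂ : ℝ≥0 → ℝ ↦ concat u (stop u (brownianCPath ω), brownianCPath ω₂) :=
      (measurable_concat u).comp (measurable_const.prodMk measurable_brownianCPath)
    have h1 : Measurable fun υ : C(ℝ≥0, ℝ) ↦ imageDrvFnK κ A (u + h) υ - imageDrvFnK κ A u υ :=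
      (measurable_imageDrvFnK κ hA hne _).sub (measurable_imageDrvFnK κ hA hne _)
    have h2 : Measurable fun υ : C(ℝ≥0, ℝ) ↦ DFnK κ A (u + h) υ ^ α * Real.exp (-(lam * JFnK κ A u h υ)) :=
      ((measurable_DFnK hA hne (u + h)).pow_const _).mul ((measurable_JFnK hA hne u h).const_mul lam).neg.exp
    exact ((h1.comp hc).mul (h2.comp hc)).sub measurable_const
  -- the bad-event envelope: `|Z − s| ≤ M₀ + 6α/ρ₀ + M₁ sup|B(ω₂)|`
  have hbad : ∀ ω₂, |Z ω₂ - s| ≤ (3482 * N + (15080 * Real.sqrt ((u + h : ℝ≥0) : ℝ) + 1160 * R) + 6 * α / ρ₀) +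
      3482 * Real.sqrt κ * runSup h ω₂ := fun ω₂ ↦ by
    have hZenv := abs_imageDrvFnK_concat_sub_le_of_abs_le (κ := κ) (h := h) hA hR0 hAR hN0 hN ω₂
    have hss : |s| ≤ 6 * α / ρ₀ := by
      rw [hs, abs_mul, abs_mul, abs_mul, abs_of_nonneg h.coe_nonneg, abs_of_nonneg hy0,
        abs_of_nonneg (by positivity : (0 : ℝ) ≤ 6 * α)]
      have h1' : 6 * α * d ^ α * |c₂| ≤ 6 * α * 1 * (1 / ρ₀) :=
        mul_le_mul (mul_le_mul_of_nonneg_left hy1 (by positivity)) hc2 (abs_nonneg _) (by positivity)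
      calc _ ≤ 6 * α * 1 * (1 / ρ₀) * 1 := mul_le_mul h1' hh1 h.coe_nonneg (by positivity)
        _ = 6 * α / ρ₀ := by ring
    have hprod : |Z ω₂| ≤ (3482 * N + (15080 * Real.sqrt ((u + h : ℝ≥0) : ℝ) + 1160 * R)) + 3482 * Real.sqrt κ * runSup h ω₂ := by
      rw [hZ]; simp only
      rw [abs_mul, abs_of_nonneg (hYh01 _).1]
      exact (mul_le_of_le_one_right (abs_nonneg _) (hYh01 _).2).trans hZenv
    calc |Z ω₂ - s| ≤ |Z ω₂| + |s| := abs_sub _ _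
      _ ≤ _ := by linarith
  -- the good event: the product expansion on top of the two deterministic one-step expansions
  have hgood : ∀ ω₂ ∈ goodEventK κ (δ₀ * ρ₀ / 4000 * (Real.sqrt κ / stepSigma)) h,
      |Z ω₂ - s - imageDriverModel (d * d ^ α) (d ^ α * c₂ * (1 + 2 * α)) h (stepDriverK κ ω₂ h)| ≤
        K * (h * stepSize (Real.sqrt κ * runSup h ω₂) h + h ^ 2 + |stepDriverK κ ω₂ h| ^ 3 + h * |stepDriverK κ ω₂ h|) := by
    intro ω₂ hω₂
    rw [goodEventK_eq_goodEvent hκ0] at hω₂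
    set υ := concat u (stop u (brownianCPath ω), brownianCPath ω₂) with hυ
    obtain ⟨hω₂K, hsS, -⟩ := goodEvent_subset_goodEventK hκ0 hκ δ₀ ρ₀ h hω₂
    set x : ℝ := stepDriverK κ ω₂ h with hx
    set rκ : ℝ := h * stepSize (Real.sqrt κ * runSup h ω₂) h + h ^ 2 + |x| ^ 3 + h * |x| with hrκ
    -- the `W̃`-side
    obtain ⟨-, hZeq⟩ := imageDrvFnK_concat_sub_eq_of_mem_goodEventK (κ := κ) hA halive hρ₀ hρ1 hBρ8 hδ0 hδ' hh0 hh32 hω₂K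
    have hM := abs_imageDriverStep_sub_model_le_of_mem_goodEventK hB hρ₀ hρ1 hBρ8 hδ0 hδ' hh0 hh32 hω₂K
    -- the `Y`-side
    obtain ⟨hDeq, -⟩ := DFnK_MFnK_concat_eq_of_good hκ hA halive hρ₀ hBρ hδ0 hδ hh0 hh32' hω₂
    obtain ⟨hJ0, hJM, hJΔ⟩ := JFnK_concat_bounds hκ hA halive hρ₀ hBρ hδ0 hδ hh0 hh32' hne hω₂
    obtain ⟨hUc, hU0⟩ := continuous_stepDriverK κ ω₂
    set S : ℝ := stepSigma * runSup h ω₂ with hSdef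
    have hSU : ∀ v : ℝ≥0, v ≤ h → |stepDriverK κ ω₂ v| ≤ S := fun v hv ↦ abs_stepDriverK_le hκ hv ω₂
    have hω₂' : S ≤ δ₀ * ρ₀ / 4000 := hω₂
    obtain ⟨-, hc1, h4, -, -, -⟩ := step_smallness hB hρ₀ hρ1 hδ0 hδ' hh32'
    have hη2 : stepSize S h ≤ 2 * (δ₀ * ρ₀ / 4000) := by rw [stepSize]; linarith
    have hη : stepSize S h ≤ starDeriv B * ρ₀ / 1000 := by
      refine hη2.trans ?_
      rw [show 2 * (δ₀ * ρ₀ / 4000) = δ₀ * ρ₀ / 2000 by ring, div_le_div_iff₀ (by norm_num) (by norm_num)]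
      linarith [mul_le_mul_of_nonneg_right hδ' hρ₀.le, mul_pos hδ0 hρ₀]
    have hη1 : stepSize S h ≤ 1 := by linarith
    have key := abs_compensatedStep_le hB hUc hU0 hh0 hSU hρ₀ hBρ8 hη hαpos hlam0 hρ1 hδ0 hδ' hη1 hh1 hlamh hJ0 hJM hJΔ
    -- the step sizes compare
    have hS0 : 0 ≤ stepSize (Real.sqrt κ * runSup h ω₂) h := by
      rw [stepSize]; have := runSup_nonneg h ω₂; positivity
    have hrcomp : (h : ℝ) * stepSize S h + h ^ 2 + |x| ^ 3 + h * |x| ≤ stepSigma / Real.sqrt κ * rκ := by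
      have h1 : (h : ℝ) * stepSize S h ≤ stepSigma / Real.sqrt κ * (h * stepSize (Real.sqrt κ * runSup h ω₂) h) := by
        have := mul_le_mul_of_nonneg_left hsS h.coe_nonneg
        linarith
      have h2 : (h : ℝ) ^ 2 + |x| ^ 3 + h * |x| ≤ stepSigma / Real.sqrt κ * (h ^ 2 + |x| ^ 3 + h * |x|) := by
        have h0 : 0 ≤ (h : ℝ) ^ 2 + |x| ^ 3 + h * |x| := by positivity
        have hratio1 : 1 ≤ stepSigma / Real.sqrt κ := by rw [le_div_iff₀ hsκ, one_mul]; exact sqrt_le_stepSigma hκ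
        have := mul_le_mul_of_nonneg_right hratio1 h0
        linarith
      have : stepSigma / Real.sqrt κ * rκ = stepSigma / Real.sqrt κ * (h * stepSize (Real.sqrt κ * runSup h ω₂) h) +
          stepSigma / Real.sqrt κ * (h ^ 2 + |x| ^ 3 + h * |x|) := by rw [hrκ]; ring
      linarith
    have hY : |starDeriv (slidHull (stepDriverK κ ω₂) B h) ^ α * Real.exp (-(lam * JFnK κ A u h υ)) - starDeriv B ^ α -
        (stepModelK α (starDeriv B) (starJet2 B) (starJet3 B) h x -
          lam * h * bubbleMass (starDeriv B) (starJet2 B / 2) (starJet3 B / 6) * starDeriv B ^ α)| ≤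
        compK α lam δ₀ ρ₀ * (stepSigma / Real.sqrt κ) * rκ := by
      refine key.trans ?_
      rw [mul_assoc]
      exact mul_le_mul_of_nonneg_left hrcomp hcompK0
    -- the hypotheses of the product expansion
    have hx1 : |x| ≤ 1 := (abs_le_of_mem_goodEventK hω₂K).1.trans (hc1.trans (by norm_num))
    have hm : |bubbleMass (starDeriv B) (starJet2 B / 2) (starJet3 B / 6)| ≤ massBound δ₀ ρ₀ := by
      rw [massBound]; exact abs_schwarzMass_le hδ0 hρ₀ hδ' hc2 hc3
    have hYh01' := hYh01 υ
    have hrκ0 : 0 ≤ rκ := by rw [hrκ]; positivity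
    have hA0 : 0 ≤ (h : ℝ) * stepSize (Real.sqrt κ * runSup h ω₂) h := mul_nonneg h.coe_nonneg hS0
    have hC0 : 0 ≤ |x| ^ 3 := pow_nonneg (abs_nonneg x) 3
    have hD0 : 0 ≤ (h : ℝ) * |x| := mul_nonneg h.coe_nonneg (abs_nonneg x)
    have hr2 : (h : ℝ) ^ 2 ≤ rκ := by rw [hrκ]; linarith
    have hr3 : |x| ^ 3 ≤ rκ := by rw [hrκ]; linarith [sq_nonneg (h : ℝ)]
    have hrx : (h : ℝ) * |x| ≤ rκ := by rw [hrκ]; linarith [sq_nonneg (h : ℝ)]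
    rw [hDeq] at hYh01'
    rw [hZ, hs]; simp only
    rw [hZeq, hDeq]
    exact hK hδ' hd1 hc2 hc3 hm hx1 hh1 hYh01'.1 hYh01'.2 hr2 hr3 hrx hM hY
  -- the abstract first-moment estimate, and the vanishing coefficient
  have key := abs_integral_sub_drift_le hκ0 hc0 hhκ hh1 hK0 hM₀ hM₁ hZm hgood hbad
  have hbadZ : ∀ ω₂, |Z ω₂| ≤ ((3482 * N + (15080 * Real.sqrt ((u + h : ℝ≥0) : ℝ) + 1160 * R) + 6 * α / ρ₀) + |s|) +
      3482 * Real.sqrt κ * runSup h ω₂ := fun ω₂ ↦ by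
    have h1 := hbad ω₂
    have h2 : |Z ω₂| ≤ |Z ω₂ - s| + |s| := by
      have := abs_add_le (Z ω₂ - s) s; rwa [sub_add_cancel] at this
    linarith
  have hZm' : Measurable Z := by
    have := hZm.add_const s; simpa using this
  have iZ : Integrable Z preWienerMeasure := integrable_of_abs_le_runSup (h := h) hZm' hbadZ
  have hint : ∫ ω₂, (Z ω₂ - s) ∂preWienerMeasure = ∫ ω₂, Z ω₂ ∂preWienerMeasure - s := by
    rw [integral_sub iZ (integrable_const s), integral_const]; simp
  rw [hint] at key
  have hcoef : (κ : ℝ) / 2 - 3 + κ * α = 0 := by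
    rw [hαdef]; field_simp; ring
  have hdrift : s + h * imageDriverDrift κ (d ^ α * c₂ * (1 + 2 * α)) = 0 := by
    have : s + h * imageDriverDrift κ (d ^ α * c₂ * (1 + 2 * α)) = h * (d ^ α * c₂ * ((κ : ℝ) / 2 - 3 + κ * α)) := by
      rw [hs, imageDriverDrift]; ring
    rw [this, hcoef, mul_zero, mul_zero]
  have : ∫ ω₂, Z ω₂ ∂preWienerMeasure - s - h * imageDriverDrift κ (d ^ α * c₂ * (1 + 2 * α)) = ∫ ω₂, Z ω₂ ∂preWienerMeasure := by
    rw [sub_sub, hdrift, sub_zero]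
  rw [this] at key
  exact key

end Frozen

section Registered

/-- **Registered form** (explicit binders) of `exists_abs_integral_frozenProd_le`: the frozen first moment of
`ΔW̃ · Ŷ′` is `O(h√h)` uniformly on the controlled class, with one product-expansion constant `K`.
[cite: LawlerSchrammWerner2003Restriction, §5 (5.1)–(5.3) and Prop. 5.3] -/
theorem exists_abs_integral_frozenProd_le_registered :
    ∀ (κ : ℝ≥0) (α lam : ℝ), 0 < κ → κ ≤ 8 / 3 → α = (6 - κ) / (2 * κ) → lam = (8 - 3 * κ) * (6 - κ) / (2 * κ) →
      ∀ (A : Set ℂ), IsStarHull A → A.Nonempty → ∀ (R : ℝ), 0 < R → A ⊆ closedBall (0 : ℂ) R →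
      ∀ (δ₀ ρ₀ : ℝ), 0 < δ₀ → 0 < ρ₀ → ρ₀ ≤ 1 →
      ∃ K : ℝ, 0 ≤ K ∧ ∀ (u h : ℝ≥0) (ω : ℝ≥0 → ℝ) (N : ℝ),
        Disjoint (closedHull (drvK κ (brownianCPath ω)) u) A →
        Disjoint (ball (0 : ℂ) (16 * ρ₀)) (Loewner.slidHull (drvK κ (brownianCPath ω)) A u) →
        2 * δ₀ ≤ starDeriv (Loewner.slidHull (drvK κ (brownianCPath ω)) A u) → 0 < h →
        (h : ℝ) ≤ 3 * (δ₀ * ρ₀ / 4000) ^ 2 / 256 → 0 ≤ N → (∀ s : ℝ≥0, s ≤ u → |drvK κ (brownianCPath ω) s| ≤ N) →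
        lam * (h * massBound δ₀ ρ₀) ≤ 1 →
        |∫ ω₂, (imageDrvFnK κ A (u + h) (PathOps.concat u (PathOps.stop u (brownianCPath ω), brownianCPath ω₂)) -
              imageDrvFnK κ A u (PathOps.concat u (PathOps.stop u (brownianCPath ω), brownianCPath ω₂))) *
            (DFnK κ A (u + h) (PathOps.concat u (PathOps.stop u (brownianCPath ω), brownianCPath ω₂)) ^ α *
              Real.exp (-(lam * JFnK κ A u h (PathOps.concat u (PathOps.stop u (brownianCPath ω), brownianCPath ω₂)))))
            ∂preWienerMeasure| ≤
        imageStepC κ (δ₀ * ρ₀ / 4000 * (Real.sqrt κ / stepSigma))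
            (starDeriv (Loewner.slidHull (drvK κ (brownianCPath ω)) A u) * starDeriv (Loewner.slidHull (drvK κ (brownianCPath ω)) A u) ^ α)
            (starDeriv (Loewner.slidHull (drvK κ (brownianCPath ω)) A u) ^ α *
              starJet2 (Loewner.slidHull (drvK κ (brownianCPath ω)) A u) * (1 + 2 * α))
            K ((3482 * N + (15080 * Real.sqrt ((u + h : ℝ≥0) : ℝ) + 1160 * R) + 6 * α / ρ₀)) (3482 * Real.sqrt κ) *
          h * Real.sqrt h := by
  intro κ α lam hκ0 hκ hαdef hlamdef A hA hne R hR0 hAR δ₀ ρ₀ hδ0 hρ₀ hρ1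
  letI : MeasurableSpace C(ℝ≥0, ℝ) := borel _
  haveI : BorelSpace C(ℝ≥0, ℝ) := ⟨rfl⟩
  obtain ⟨K, hK0, hK⟩ := exists_abs_integral_frozenProd_le hκ0 hκ hαdef hlamdef hA hne hR0 hAR hδ0 hρ₀ hρ1
  exact ⟨K, hK0, fun u h ω N halive hBρ hδ hh0 hh hN0 hN hlamh ↦ hK halive hBρ hδ hh0 hh hN0 hN hlamh⟩

end Registered

end Summit.CriticalPhenomena.SAWScalingLimit.Theorems.SubseqIdentification.BoundaryAreaLaw

end
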